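import Summits.BirchSwinnertonDyer.Rank1Residual.X11b.RouteR1IntReceptacle
import Summits.BirchSwinnertonDyer.Rank1Residual.X11b.UnrIntegersValuationRing
import Summits.BirchSwinnertonDyer.Rank1Residual.X11b.CharIdealTrivialCharacter
import Summits.BirchSwinnertonDyer.Rank1Residual.X11b.FrameLambdaUnit
import HarnessLib
import Summits.BirchSwinnertonDyer.Rank1Residual.X11b.FrameIdealRigidity

/-!
# ♭ ⟹ R₀ for the two INCLUSION cruxes at the wild split prime: divisibility of power series descends from
# `𝓞_{ℂ_p}⟦T⟧` to `R₀⟦T⟧`, so the ♭-typed inclusions `(Q) ⊆ Ch·𝓞_{ℂ_p}⟦T⟧` / `Ch·𝓞_{ℂ_p}⟦T⟧ ⊆ (Q)` imply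
# the `R₀`-typed texts of UTD 20395 `AdditiveSplitIMCInclusionAtThree` / SOED 20479
# `WildSplitEisensteinInclusionAtThree` at every frame where `Ch_Λ(X_(∅,0))` is principal (control) —
# «the ♭ re-type loses nothing» (route-free; cell `bsd-wall`, D-0131 (3) M-UTD, seat `bsd-wall-utd-p3` gen 2)

Context. The UTD/SOED inclusion cruxes are typed in the `R₀`-receptacle (`L : UnrSeries p = R₀⟦T⟧`,
`R₀ = unrIntegers p = 𝓞(ℚ_p^ur)^`, frames `IsBDPLFunction`, `Ideal.map (PowerSeries.map (toUnr p))`),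
while every kernel consequence (the index sockets, `BSD_p`) needs only the ♭-receptacle
(`Q : 𝓞_{ℂ_p}⟦T⟧`, `R1.IsBDPLFunctionInt`, `Ideal.map (PowerSeries.map (R1.toCpInt p))`) — kmc g19 FINDING
(pub/bsd-potss/bsd-potss-kmc/g19/FINDING-UTD-20385-kmc-g19.md §2–§3: the `R₀` currency is the only gap of
crux #4 20385; option (A) «♭ RE-TYPE» of 20186/20395/20399/20400/20214/20385; the `R₀`-DESCENT of the
BDP measure at `27 ∣ N` = child 20928, unprinted). The ♭ frames exist from print (Hsieh 2014 Thm A, any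
level); `R₀`-frames need 20928. `R₀ ⟹ ♭` for a statement about ALL frames holds only at `R₀`-rational
frames; THIS FILE proves the converse direction needed to retire the `R₀` texts: **♭ ⟹ `R₀`**, for both
inclusions, at every frame where `Ch_Λ(X)` is principal (which the control theorem `WildSplitControlAtThree`
supplies wherever the kernels read the inclusion).

* §1 `dvd_of_map_unrToCpInt_dvd` — for `f, L ∈ R₀⟦T⟧`: `f ∣ L` in `𝓞_{ℂ_p}⟦T⟧` ⟹ `f ∣ L` in `R₀⟦T⟧`.
  Proof: triangular recursion for the quotient's coefficients with pivot the first non-zero coefficient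
  of `f` ⟹ they lie in `Frac R₀`; norm `≤ 1`; `R₀` is the valuation ring of `Frac R₀` (x11b
  `R1.mem_unrIntegers_of_mem_fracUnr`). `span_singleton_le_iff_of_map_unrToCpInt` (both directions).
* §2 `span_le_map_toUnr_of_flat` / `map_toUnr_le_span_of_flat` — for a PRINCIPAL ideal `I` of
  `Λ = ℤ_p⟦T⟧` and `L ∈ R₀⟦T⟧`: `(L^♭) ⊆ I·𝓞_{ℂ_p}⟦T⟧ ⟹ (L) ⊆ I·R₀⟦T⟧` and
  `I·𝓞_{ℂ_p}⟦T⟧ ⊆ (L^♭) ⟹ I·R₀⟦T⟧ ⊆ (L)` (`L^♭ = PowerSeries.map unrToCpInt L`;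
  `R1.unrToCpInt_comp_toUnr`).
* §3 `unrInclGe_of_flatInclGe` / `unrInclLe_of_flatInclLe` — at a frame `(κ, 𝔭′, γ)` with
  `XAc.HasCharValuationAt (W.baseChange K) p κ 𝔭′ ∅ γ n` (control: torsion + principal `Ch`) and frame
  data `(ι′, 𝔭, f, Ω_K, Ω_p)`: the ♭-inclusion for EVERY ♭-frame `Q` (kmc g20's `hIncl` shapes) ⟹ the
  `R₀`-inclusion for EVERY `R₀`-frame `L` (20395's resp. 20479's conclusion shape), via
  `R1.isBDPLFunctionInt_map`.

* §4 (appended) `flatInclGe_of_unrInclGe_of_frame` / `flatInclLe_of_unrInclLe_of_frame` — the converse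
  `R₀ ⟹ ♭` at a frame datum that HAS one `R₀`-frame (no control), by the cross-period ideal rigidity
  `R1.span_singleton_eq_of_isBDPLFunctionInt`: at `R₀`-rational frames (child 20928) the two typings agree.

Consequence for the steward (UTD/SOED): re-typing 20395 / 20479 (and 20186's conclusion) in ♭ is a pure
STRENGTHENING whose `R₀` texts of record remain derivable wherever they are consumed (the kernels read the
inclusions only through control at `𝔭′`), while the consumers' port debt drops 20928 (kmc option A; gen 2's
`…AdditiveSplitIMCInclusionAtThreeCertificates` §2 is already typed in ♭). HONEST FRAMING: elementary
algebra over the tree's `R₀ ⊂ 𝓞_{ℂ_p}`; nothing about any curve is asserted; no definition, no named fact,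
no `sorry`. References: [Castella2018] §3 (arXiv:1704.06608 p. 9: `R₀`, `Λ_{R₀}`); [Hsieh2014] p. 7
(the receptacle `Z̄_p⟦Γ⁻⟧ ⊆ 𝓞_{ℂ_p}⟦T⟧`); [Cassels1986] Ch. 4 (valuation ring of `ℚ_p^ur^`); folklore.
-/

noncomputable section

open scoped Classical

set_option linter.dupNamespace false
set_option autoImplicit false

namespace Summit.BirchSwinnertonDyer.BirchSwinnertonDyer.Theorems.WildThreeInclusionKernel

open PowerSeries Literature.NumberTheory.EllipticCurves
  Summit.BirchSwinnertonDyer.Rank1Residual.X11b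
  Summit.BirchSwinnertonDyer.Rank1Residual.X11b.Halves
  Summit.BirchSwinnertonDyer.Rank1Residual.X11b.CongruenceLimit

variable {p : ℕ} [Fact p.Prime]

/-- **Descent of power-series DIVISIBILITY from `𝓞_{ℂ_p}⟦T⟧` to `R₀⟦T⟧`.** For `f, L ∈ R₀⟦T⟧`
(`R₀ = unrIntegers p`): if `f ∣ L` after extension of scalars to `𝓞_{ℂ_p}⟦T⟧`, then `f ∣ L` in `R₀⟦T⟧`.
Proof: the quotient's coefficients satisfy a triangular recursion with pivot the first non-zero
coefficient of `f`, so they lie in `Frac R₀`; they have norm `≤ 1`; and `R₀` is the valuation ring of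
`Frac R₀` (`R1.mem_unrIntegers_of_mem_fracUnr`). [folklore] -/
theorem dvd_of_map_unrToCpInt_dvd {f L : PowerSeries (unrIntegers p)}
    (h : PowerSeries.map (R1.unrToCpInt p) f ∣ PowerSeries.map (R1.unrToCpInt p) L) : f ∣ L := by
  obtain ⟨g, hg⟩ := h
  by_cases hf : f = 0
  · -- `f = 0`: then `L = 0`
    subst hf
    have hL : PowerSeries.map (R1.unrToCpInt p) L = 0 := by rw [hg, map_zero, zero_mul]
    have : L = 0 := PowerSeries.map_injective _ R1.unrToCpInt_injective (by rw [hL, map_zero])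
    rw [this]
  -- the first non-zero coefficient of `f`
  have hex : ∃ m, coeff m f ≠ 0 := by
    by_contra hall
    push Not at hall
    exact hf (PowerSeries.ext fun m ↦ by simpa using hall m)
  let m := Nat.find hex
  have hm : coeff m f ≠ 0 := Nat.find_spec hex
  have hlt : ∀ i < m, coeff i f = 0 := fun i hi ↦ by
    have := Nat.find_min hex hi
    simpa using this
  -- notation
  set S : Subfield ℂ_[p] := Subfield.closure (unrIntegers p : Set ℂ_[p]) with hS
  have hR0S : ∀ x : unrIntegers p, (x : ℂ_[p]) ∈ S := fun x ↦ Subfield.subset_closure x.2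
  -- the coefficient identity in `ℂ_p`: `L_{n+m} = Σ_{(i,j) ∈ antidiag(n+m)} f_i g_j`
  have hcoeff : ∀ n : ℕ, ((coeff (n + m) L : unrIntegers p) : ℂ_[p]) =
      ∑ ij ∈ Finset.HasAntidiagonal.antidiagonal (n + m),
        ((coeff ij.1 f : unrIntegers p) : ℂ_[p]) * ((coeff ij.2 g : 𝓞_ℂ_[p]) : ℂ_[p]) := by
    intro n
    have h1 := congrArg (fun φ ↦ ((coeff (n + m) φ : 𝓞_ℂ_[p]) : ℂ_[p])) hg
    simp only [coeff_map, R1.coe_unrToCpInt, coeff_mul] at h1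
    rw [h1]
    push_cast
    refine Finset.sum_congr rfl fun ij _ ↦ ?_
    rw [R1.coe_unrToCpInt]
  -- every coefficient of `g` lies in `Frac R₀` (strong induction)
  have hgS : ∀ n : ℕ, ((coeff n g : 𝓞_ℂ_[p]) : ℂ_[p]) ∈ S := by
    intro n
    induction n using Nat.strong_induction_on with
    | _ n ih =>
      have hmem : (m, n) ∈ Finset.HasAntidiagonal.antidiagonal (n + m) := by
        rw [Finset.HasAntidiagonal.mem_antidiagonal]; exact Nat.add_comm m n
      have hsplit := Finset.add_sum_erase (Finset.HasAntidiagonal.antidiagonal (n + m))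
        (fun ij : ℕ × ℕ ↦ ((coeff ij.1 f : unrIntegers p) : ℂ_[p]) * ((coeff ij.2 g : 𝓞_ℂ_[p]) : ℂ_[p]))
        hmem
      -- the other terms lie in `S`
      have hrest : ∑ ij ∈ (Finset.HasAntidiagonal.antidiagonal (n + m)).erase (m, n),
          ((coeff ij.1 f : unrIntegers p) : ℂ_[p]) * ((coeff ij.2 g : 𝓞_ℂ_[p]) : ℂ_[p]) ∈ S := by
        refine Subfield.sum_mem _ fun ij hij ↦ ?_
        obtain ⟨hne, hij'⟩ := Finset.mem_erase.mp hij
        rw [Finset.HasAntidiagonal.mem_antidiagonal] at hij'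
        rcases lt_trichotomy ij.1 m with hi | hi | hi
        · rw [hlt ij.1 hi]; simp [S.zero_mem]
        · exfalso; apply hne
          have h2 : ij.2 = n := by omega
          exact Prod.ext hi h2
        · have hj : ij.2 < n := by omega
          exact S.mul_mem (hR0S _) (ih ij.2 hj)
      -- `f_m · g_n = L_{n+m} − rest ∈ S`
      have hprod : ((coeff m f : unrIntegers p) : ℂ_[p]) * ((coeff n g : 𝓞_ℂ_[p]) : ℂ_[p]) ∈ S := by
        have heq : ((coeff m f : unrIntegers p) : ℂ_[p]) * ((coeff n g : 𝓞_ℂ_[p]) : ℂ_[p]) =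
            ((coeff (n + m) L : unrIntegers p) : ℂ_[p]) -
              ∑ ij ∈ (Finset.HasAntidiagonal.antidiagonal (n + m)).erase (m, n),
                ((coeff ij.1 f : unrIntegers p) : ℂ_[p]) * ((coeff ij.2 g : 𝓞_ℂ_[p]) : ℂ_[p]) := by
          rw [hcoeff n, ← hsplit]; ring
        rw [heq]
        exact S.sub_mem (hR0S _) hrest
      have hfm : ((coeff m f : unrIntegers p) : ℂ_[p]) ≠ 0 := by
        intro h0; apply hm; exact Subtype.ext h0
      have : ((coeff n g : 𝓞_ℂ_[p]) : ℂ_[p]) =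
          ((coeff m f : unrIntegers p) : ℂ_[p])⁻¹ *
            (((coeff m f : unrIntegers p) : ℂ_[p]) * ((coeff n g : 𝓞_ℂ_[p]) : ℂ_[p])) := by
        rw [← mul_assoc, inv_mul_cancel₀ hfm, one_mul]
      rw [this]
      exact S.mul_mem (S.inv_mem (hR0S _)) hprod
  -- hence in `R₀` (valuation ring), so `g` descends
  have hgR : ∀ n : ℕ, ((coeff n g : 𝓞_ℂ_[p]) : ℂ_[p]) ∈ unrIntegers p := fun n ↦
    R1.mem_unrIntegers_of_mem_fracUnr (hgS n) (R1.norm_coe_padicComplexInt_le_one p _)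
  let g₀ : PowerSeries (unrIntegers p) := PowerSeries.mk fun n ↦ ⟨_, hgR n⟩
  have hg₀ : PowerSeries.map (R1.unrToCpInt p) g₀ = g := by
    ext n
    rw [coeff_map, R1.coe_unrToCpInt]
    simp [g₀]
  refine ⟨g₀, PowerSeries.map_injective _ R1.unrToCpInt_injective ?_⟩
  rw [map_mul, hg₀, hg]

/-- **Principal-ideal inclusions descend** (both directions packaged): for `f, L ∈ R₀⟦T⟧`,
`(L^♭) ⊆ (f^♭)` in `𝓞_{ℂ_p}⟦T⟧` iff `(L) ⊆ (f)` in `R₀⟦T⟧`. [folklore] -/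
theorem span_singleton_le_iff_of_map_unrToCpInt (f L : PowerSeries (unrIntegers p)) :
    Ideal.span {PowerSeries.map (R1.unrToCpInt p) L} ≤ Ideal.span {PowerSeries.map (R1.unrToCpInt p) f} ↔
      Ideal.span {L} ≤ Ideal.span {f} := by
  rw [Ideal.span_singleton_le_span_singleton, Ideal.span_singleton_le_span_singleton]
  exact ⟨dvd_of_map_unrToCpInt_dvd, fun h ↦ map_dvd (PowerSeries.map (R1.unrToCpInt p)) h⟩

/-! ### §2 Principal ideals of `Λ = ℤ_p⟦T⟧` extended to `R₀⟦T⟧` and to `𝓞_{ℂ_p}⟦T⟧` -/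

/-- `I·𝓞_{ℂ_p}⟦T⟧ = (I·R₀⟦T⟧)·𝓞_{ℂ_p}⟦T⟧` for an ideal `I` of `Λ` (`R1.toCpInt = unrToCpInt ∘ toUnr`). [folklore] -/
theorem map_toCpInt_eq_map_map (I : Ideal (PowerSeries ℤ_[p])) :
    I.map (PowerSeries.map (R1.toCpInt p)) =
      (I.map (PowerSeries.map (toUnr p))).map (PowerSeries.map (R1.unrToCpInt p)) := by
  rw [Ideal.map_map, ← PowerSeries.map_comp, R1.unrToCpInt_comp_toUnr]

/-- **`(L^♭) ⊆ I·𝓞_{ℂ_p}⟦T⟧ ⟹ (L) ⊆ I·R₀⟦T⟧`** for a PRINCIPAL ideal `I` of `Λ = ℤ_p⟦T⟧` and `L ∈ R₀⟦T⟧`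
(the «⊇»/Howard–Kolyvagin direction: UTD 20395's shape). [folklore] -/
theorem span_le_map_toUnr_of_flat {I : Ideal (PowerSeries ℤ_[p])} (hI : ∃ f, I = Ideal.span {f})
    {L : PowerSeries (unrIntegers p)}
    (h : Ideal.span {PowerSeries.map (R1.unrToCpInt p) L} ≤ I.map (PowerSeries.map (R1.toCpInt p))) :
    Ideal.span {L} ≤ I.map (PowerSeries.map (toUnr p)) := by
  obtain ⟨f, rfl⟩ := hI
  rw [map_toCpInt_eq_map_map, map_span_singleton_powerSeries, map_span_singleton_powerSeries] at h
  rw [map_span_singleton_powerSeries]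
  exact (span_singleton_le_iff_of_map_unrToCpInt _ _).mp h

/-- **`I·𝓞_{ℂ_p}⟦T⟧ ⊆ (L^♭) ⟹ I·R₀⟦T⟧ ⊆ (L)`** for a PRINCIPAL ideal `I` of `Λ` and `L ∈ R₀⟦T⟧` (the
«⊆»/Eisenstein direction: SOED 20479's shape). [folklore] -/
theorem map_toUnr_le_span_of_flat {I : Ideal (PowerSeries ℤ_[p])} (hI : ∃ f, I = Ideal.span {f})
    {L : PowerSeries (unrIntegers p)}
    (h : I.map (PowerSeries.map (R1.toCpInt p)) ≤ Ideal.span {PowerSeries.map (R1.unrToCpInt p) L}) :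
    I.map (PowerSeries.map (toUnr p)) ≤ Ideal.span {L} := by
  obtain ⟨f, rfl⟩ := hI
  rw [map_toCpInt_eq_map_map, map_span_singleton_powerSeries, map_span_singleton_powerSeries] at h
  rw [map_span_singleton_powerSeries]
  exact (span_singleton_le_iff_of_map_unrToCpInt _ _).mp h

/-! ### §3 At an anticyclotomic frame with control: the ♭-inclusions for every ♭-frame give the `R₀`-inclusions for every `R₀`-frame -/

section Frame

open NumberField IsDedekindDomain AcSelmer

variable {K : Type} [Field K] [NumberField K] {N : ℕ} (W : WeierstrassCurve ℚ)
  (κ : ZpExtension K p) (𝔭' : HeightOneSpectrum (𝓞 K)) (γ : Field.absoluteGaloisGroup K)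
  [Fact (κ.IsTopGenerator γ)]

/-- **UTD 20395's conclusion shape from its ♭ form.** At a frame `(κ, 𝔭′, γ)` where `Ch_Λ(X_(∅,0))` is
principal with non-zero constant term (`XAc.HasCharValuationAt … n`, supplied by the control theorem), and
frame data `(ι′, 𝔭, f, Ω_K, Ω_p)`: IF every ♭-frame `Q ∈ 𝓞_{ℂ_p}⟦T⟧` satisfies
`(Q) ⊆ Ch·𝓞_{ℂ_p}⟦T⟧`, THEN every `R₀`-frame `L` satisfies `(L) ⊆ Ch·R₀⟦T⟧` (`L^♭` is a ♭-frame by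
`R1.isBDPLFunctionInt_map`; §2). [folklore] [cite: Castella2018, §3 (arXiv:1704.06608 p. 9)] -/
theorem unrInclGe_of_flatInclGe {n : ℕ} (hn : XAc.HasCharValuationAt (W.baseChange K) p κ 𝔭' ∅ γ n)
    {ι' : PadicAlgCl p ≃+* ℂ} {𝔭 : HeightOneSpectrum (𝓞 K)} {f : CuspForm (CongruenceSubgroup.Gamma0 N) 2}
    {ΩK : ℂ} {Ωp : ℂ_[p]}
    (hflat : ∀ Q : PowerSeries 𝓞_ℂ_[p], R1.IsBDPLFunctionInt p ι' 𝔭 κ γ f ΩK Ωp Q →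
      Ideal.span {Q} ≤ (XAc.charIdeal (W.baseChange K) p κ 𝔭' ∅ γ).map (PowerSeries.map (R1.toCpInt p)))
    (L : UnrSeries p) (hL : IsBDPLFunction ι' 𝔭 κ γ f ΩK Ωp L) :
    Ideal.span {L} ≤ (XAc.charIdeal (W.baseChange K) p κ 𝔭' ∅ γ).map (PowerSeries.map (toUnr p)) := by
  obtain ⟨-, g, hg, -, -⟩ := hn
  exact span_le_map_toUnr_of_flat ⟨g, hg⟩ (hflat _ (R1.isBDPLFunctionInt_map hL))

/-- **SOED 20479's conclusion shape from its ♭ form** (same frame and control package): IF every ♭-frame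
`Q` satisfies `Ch·𝓞_{ℂ_p}⟦T⟧ ⊆ (Q)`, THEN every `R₀`-frame `L` satisfies `Ch·R₀⟦T⟧ ⊆ (L)`. [folklore]
[cite: Castella2018, §3 (arXiv:1704.06608 p. 9)] -/
theorem unrInclLe_of_flatInclLe {n : ℕ} (hn : XAc.HasCharValuationAt (W.baseChange K) p κ 𝔭' ∅ γ n)
    {ι' : PadicAlgCl p ≃+* ℂ} {𝔭 : HeightOneSpectrum (𝓞 K)} {f : CuspForm (CongruenceSubgroup.Gamma0 N) 2}
    {ΩK : ℂ} {Ωp : ℂ_[p]}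
    (hflat : ∀ Q : PowerSeries 𝓞_ℂ_[p], R1.IsBDPLFunctionInt p ι' 𝔭 κ γ f ΩK Ωp Q →
      (XAc.charIdeal (W.baseChange K) p κ 𝔭' ∅ γ).map (PowerSeries.map (R1.toCpInt p)) ≤ Ideal.span {Q})
    (L : UnrSeries p) (hL : IsBDPLFunction ι' 𝔭 κ γ f ΩK Ωp L) :
    (XAc.charIdeal (W.baseChange K) p κ 𝔭' ∅ γ).map (PowerSeries.map (toUnr p)) ≤ Ideal.span {L} := by
  obtain ⟨-, g, hg, -, -⟩ := hn
  exact map_toUnr_le_span_of_flat ⟨g, hg⟩ (hflat _ (R1.isBDPLFunctionInt_map hL))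

/-- **EQUALITY descends too**: ♭-equality `Ch·𝓞_{ℂ_p}⟦T⟧ = (Q)` for every ♭-frame ⟹ `R₀`-equality
`Ch·R₀⟦T⟧ = (L)` for every `R₀`-frame (20186 `ToricTransportModThree`'s conclusion shape / kmc's `hEq♭`).
[folklore] [cite: Castella2018, §3 (arXiv:1704.06608 p. 9)] -/
theorem unrEq_of_flatEq {n : ℕ} (hn : XAc.HasCharValuationAt (W.baseChange K) p κ 𝔭' ∅ γ n)
    {ι' : PadicAlgCl p ≃+* ℂ} {𝔭 : HeightOneSpectrum (𝓞 K)} {f : CuspForm (CongruenceSubgroup.Gamma0 N) 2}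
    {ΩK : ℂ} {Ωp : ℂ_[p]}
    (hflat : ∀ Q : PowerSeries 𝓞_ℂ_[p], R1.IsBDPLFunctionInt p ι' 𝔭 κ γ f ΩK Ωp Q →
      (XAc.charIdeal (W.baseChange K) p κ 𝔭' ∅ γ).map (PowerSeries.map (R1.toCpInt p)) = Ideal.span {Q})
    (L : UnrSeries p) (hL : IsBDPLFunction ι' 𝔭 κ γ f ΩK Ωp L) :
    (XAc.charIdeal (W.baseChange K) p κ 𝔭' ∅ γ).map (PowerSeries.map (toUnr p)) = Ideal.span {L} :=
  le_antisymm (unrInclLe_of_flatInclLe W κ 𝔭' γ hn (fun Q hQ ↦ (hflat Q hQ).le) L hL)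
    (unrInclGe_of_flatInclGe W κ 𝔭' γ hn (fun Q hQ ↦ (hflat Q hQ).ge) L hL)

end Frame

/-! ### §4 (appended, gen 2) The converse `R₀ ⟹ ♭` at a frame datum that HAS one `R₀`-frame (no control needed) -/

section Converse

open NumberField IsDedekindDomain AcSelmer

variable {K : Type} [Field K] [NumberField K] {N : ℕ} (W : WeierstrassCurve ℚ)
  (κ : ZpExtension K p) (𝔭' : HeightOneSpectrum (𝓞 K)) (γ : Field.absoluteGaloisGroup K)
  [Fact (κ.IsTopGenerator γ)]

/-- **`R₀ ⟹ ♭` for the «⊇» inclusion, given ONE `R₀`-frame.** Odd `p`, `K` imaginary quadratic, `κ`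
anticyclotomic with generator `γ`, frame data `(ι′, 𝔭, f)`: if some `R₀`-frame `L₀` (non-zero periods
`Ω_K⁰, Ω_p⁰`) satisfies `(L₀) ⊆ Ch·R₀⟦T⟧`, then EVERY ♭-frame `Q` (any non-zero periods) satisfies
`(Q) ⊆ Ch·𝓞_{ℂ_p}⟦T⟧` — by the cross-period ideal rigidity `R1.span_singleton_eq_of_isBDPLFunctionInt`
(`(Q) = (L₀^♭)`) and `Ideal.map_mono`. So at an `R₀`-rational frame (UTD child 20928) the `R₀` and ♭ texts of
20395 are EQUIVALENT (with §3); without an `R₀`-frame only ♭ ⟹ `R₀` (§3) is available. [folklore]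
[cite: Castella2018, §3 and Thm. 3.1 (arXiv:1704.06608 p. 9)] -/
theorem flatInclGe_of_unrInclGe_of_frame (hp2 : p ≠ 2) (hK : IsImaginaryQuadratic K)
    (hκ : κ.IsAnticyclotomic) {ι' : PadicAlgCl p ≃+* ℂ} {𝔭 : HeightOneSpectrum (𝓞 K)}
    {f : CuspForm (CongruenceSubgroup.Gamma0 N) 2} {ΩK₀ : ℂ} {Ωp₀ : ℂ_[p]} (hΩK₀ : ΩK₀ ≠ 0) (hΩp₀ : Ωp₀ ≠ 0)
    {L₀ : UnrSeries p} (hL₀ : IsBDPLFunction ι' 𝔭 κ γ f ΩK₀ Ωp₀ L₀)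
    (hincl : Ideal.span {L₀} ≤ (XAc.charIdeal (W.baseChange K) p κ 𝔭' ∅ γ).map (PowerSeries.map (toUnr p)))
    {ΩK : ℂ} {Ωp : ℂ_[p]} (hΩK : ΩK ≠ 0) (hΩp : Ωp ≠ 0) (Q : PowerSeries 𝓞_ℂ_[p])
    (hQ : R1.IsBDPLFunctionInt p ι' 𝔭 κ γ f ΩK Ωp Q) :
    Ideal.span {Q} ≤ (XAc.charIdeal (W.baseChange K) p κ 𝔭' ∅ γ).map (PowerSeries.map (R1.toCpInt p)) := by
  have hγ : κ.IsTopGenerator γ := Fact.out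
  have heq : Ideal.span ({Q} : Set (PowerSeries 𝓞_ℂ_[p])) =
      Ideal.span {PowerSeries.map (R1.unrToCpInt p) L₀} :=
    R1.span_singleton_eq_of_isBDPLFunctionInt hp2 hK hκ hγ hΩK₀ hΩK hΩp₀ hΩp (R1.isBDPLFunctionInt_map hL₀) hQ
  rw [heq, map_toCpInt_eq_map_map, ← map_span_singleton_powerSeries]
  exact Ideal.map_mono hincl

/-- **`R₀ ⟹ ♭` for the «⊆» (Eisenstein) inclusion, given ONE `R₀`-frame** (same data): `Ch·R₀⟦T⟧ ⊆ (L₀)`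
for an `R₀`-frame `L₀` ⟹ `Ch·𝓞_{ℂ_p}⟦T⟧ ⊆ (Q)` for every ♭-frame `Q`. [folklore]
[cite: Castella2018, §3 and Thm. 3.1 (arXiv:1704.06608 p. 9)] -/
theorem flatInclLe_of_unrInclLe_of_frame (hp2 : p ≠ 2) (hK : IsImaginaryQuadratic K)
    (hκ : κ.IsAnticyclotomic) {ι' : PadicAlgCl p ≃+* ℂ} {𝔭 : HeightOneSpectrum (𝓞 K)}
    {f : CuspForm (CongruenceSubgroup.Gamma0 N) 2} {ΩK₀ : ℂ} {Ωp₀ : ℂ_[p]} (hΩK₀ : ΩK₀ ≠ 0) (hΩp₀ : Ωp₀ ≠ 0)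
    {L₀ : UnrSeries p} (hL₀ : IsBDPLFunction ι' 𝔭 κ γ f ΩK₀ Ωp₀ L₀)
    (hincl : (XAc.charIdeal (W.baseChange K) p κ 𝔭' ∅ γ).map (PowerSeries.map (toUnr p)) ≤ Ideal.span {L₀})
    {ΩK : ℂ} {Ωp : ℂ_[p]} (hΩK : ΩK ≠ 0) (hΩp : Ωp ≠ 0) (Q : PowerSeries 𝓞_ℂ_[p])
    (hQ : R1.IsBDPLFunctionInt p ι' 𝔭 κ γ f ΩK Ωp Q) :
    (XAc.charIdeal (W.baseChange K) p κ 𝔭' ∅ γ).map (PowerSeries.map (R1.toCpInt p)) ≤ Ideal.span {Q} := by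
  have hγ : κ.IsTopGenerator γ := Fact.out
  have heq : Ideal.span ({Q} : Set (PowerSeries 𝓞_ℂ_[p])) =
      Ideal.span {PowerSeries.map (R1.unrToCpInt p) L₀} :=
    R1.span_singleton_eq_of_isBDPLFunctionInt hp2 hK hκ hγ hΩK₀ hΩK hΩp₀ hΩp (R1.isBDPLFunctionInt_map hL₀) hQ
  rw [heq, map_toCpInt_eq_map_map, ← map_span_singleton_powerSeries]
  exact Ideal.map_mono hincl

end Converse

end Summit.BirchSwinnertonDyer.BirchSwinnertonDyer.Theorems.WildThreeInclusionKernel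

end
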